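import Summits.CriticalPhenomena.CardyFormulaZ2.Theorems.CardyIKTransportIKLinearTransportScreeningArray

/-!
# Screening estimates for a finite array of independent biased bits, part 3: Fourier–Walsh expansion, counting

Support file (`--supports stmt-CriticalPhenomena-5076`, registered helper `arrSum_indicator_expand`) for the stub
`stub_Screening` of the line `pinned-diagram-exchange` (crux `IKLinearTransport`); continues part 1
(`…ScreeningArray`), prepares part 4 (`screeningArray`).
* `indicator_expand` / `arrSum_indicator_expand`: `1[parities q = kk] = 2^{-(m+k)} Σ_{C,R} ε(C,R) χ_{X(C,R)}(q)`,
  `X(C,R) = {(c,r) : [c ∈ C] ≠ [r ∈ R]}` (`xSet`), `ε(C,R) = (-1)^{Σ_{c∈C} kk.1 c + Σ_{r∈R} kk.2 r}` (`epsCR`),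
  hence `E[F; parities = kk] = 2^{-(m+k)} Σ_{C,R} ε(C,R) E[χ_{X(C,R)} F]`.
* `abs_arrSum_chiY_mul_le`: for `F ∈ [0,1]` reading only `{c ≥ n} × {r ≥ n}`, `|E[χ_X F]| ≤ θ^{#(X ∖ UR)}`
  (`nOut n C R = #(X(C,R) ∖ UR)`).
* Counting (`le_nOut_of_*`): lower bounds for `#(X(C,R) ∖ UR)` in the cases of the screening sum, and the
  generating sums `Σ_{C : low part ≡ v} T^{#{C = ¬v}} = (1+T)^{m-n}` (`sum_low_const_pow`,
  `sum_pair_low_const_pow`).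
-/

namespace Summit.CriticalPhenomena.CardyFormulaZ2.Theorems.IKLinearTransport.PinnedDiagramExchange.ScreeningArray

open Finset

variable {m k : ℕ}

/-! ## Fourier–Walsh expansion of the parity indicator -/

/-- `|χ_S(q)| = 1`. -/
theorem abs_chiY (S : Finset (Fin m × Fin k)) (q : Fin m × Fin k → Bool) : |chiY S q| = 1 := by
  unfold chiY
  rw [Finset.abs_prod]
  simp [abs_sgnR]

/-- `|ε(C,R)| = 1`. -/
theorem abs_epsCR (kk : (Fin m → Bool) × (Fin k → Bool)) (C : Fin m → Bool) (R : Fin k → Bool) :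
    |epsCR kk C R| = 1 := by
  unfold epsCR
  rw [abs_mul, Finset.abs_prod, Finset.abs_prod]
  have h1 : ∀ c, |(if C c then sgnR (kk.1 c) else 1)| = 1 := fun c => by
    split_ifs <;> simp [abs_sgnR]
  have h2 : ∀ r, |(if R r then sgnR (kk.2 r) else 1)| = 1 := fun r => by
    split_ifs <;> simp [abs_sgnR]
  simp [h1, h2]

/-- Indicator of one column parity: `1[colPar q c = v] = (1 + (-1)^v ∏_r (-1)^{q(c,r)}) / 2`. -/
theorem ind_colPar (q : Fin m × Fin k → Bool) (c : Fin m) (v : Bool) :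
    (if colPar q c = v then (1 : ℝ) else 0) = (1 + sgnR v * ∏ r, sgnR (q (c, r))) / 2 := by
  rw [prod_sgnR]
  unfold colPar
  generalize decide (Odd ((univ.filter fun r : Fin k => q (c, r) = true).card)) = b
  cases b <;> cases v <;> norm_num [sgnR]

/-- Indicator of one row parity: `1[rowPar q r = v] = (1 + (-1)^v ∏_c (-1)^{q(c,r)}) / 2`. -/
theorem ind_rowPar (q : Fin m × Fin k → Bool) (r : Fin k) (v : Bool) :
    (if rowPar q r = v then (1 : ℝ) else 0) = (1 + sgnR v * ∏ c, sgnR (q (c, r))) / 2 := by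
  rw [prod_sgnR]
  unfold rowPar
  generalize decide (Odd ((univ.filter fun c : Fin m => q (c, r) = true).card)) = b
  cases b <;> cases v <;> norm_num [sgnR]

/-- Subset expansion `∏_i (1 + a_i)/2 = 2^{-#ι} Σ_{C ⊆ ι} ∏_{i ∈ C} a_i`, subsets coded as `ι → Bool`. -/
theorem prod_half_one_add {ι : Type*} [Fintype ι] [DecidableEq ι] (a : ι → ℝ) :
    ∏ i, (1 + a i) / 2 = (∑ C : ι → Bool, ∏ i, if C i then a i else 1) / 2 ^ Fintype.card ι := by
  rw [Finset.prod_div_distrib, Finset.prod_const, Finset.card_univ]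
  congr 1
  rw [← Fintype.prod_sum fun (i : ι) (b : Bool) => if b then a i else 1]
  refine Finset.prod_congr rfl fun i _ => ?_
  rw [Fintype.sum_bool]
  simp only [if_true, Bool.false_eq_true, if_false]
  ring

/-- Termwise identity of the expansion: `∏_{c ∈ C} s_c(q) ∏_{r ∈ R} t_r(q) = ε(C,R) χ_{X(C,R)}(q)`
(an entry of `C × R` is counted twice, hence drops out). -/
theorem term_eq_eps_chi (q : Fin m × Fin k → Bool) (kk : (Fin m → Bool) × (Fin k → Bool))
    (C : Fin m → Bool) (R : Fin k → Bool) :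
    (∏ c, if C c then sgnR (kk.1 c) * ∏ r, sgnR (q (c, r)) else 1) *
        (∏ r, if R r then sgnR (kk.2 r) * ∏ c, sgnR (q (c, r)) else 1) =
      epsCR kk C R * chiY (xSet C R) q := by
  have h1 : ∀ c, (if C c then sgnR (kk.1 c) * ∏ r, sgnR (q (c, r)) else 1) =
      (if C c then sgnR (kk.1 c) else 1) * ∏ r, (if C c then sgnR (q (c, r)) else 1) := fun c => by
    cases C c <;> simp
  have h2 : ∀ r, (if R r then sgnR (kk.2 r) * ∏ c, sgnR (q (c, r)) else 1) =
      (if R r then sgnR (kk.2 r) else 1) * ∏ c, (if R r then sgnR (q (c, r)) else 1) := fun r => by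
    cases R r <;> simp
  simp only [h1, h2, Finset.prod_mul_distrib]
  have h3 : (∏ c, ∏ r, (if C c then sgnR (q (c, r)) else 1)) =
      ∏ f : Fin m × Fin k, (if C f.1 then sgnR (q f) else 1) :=
    (Fintype.prod_prod_type fun f : Fin m × Fin k => if C f.1 then sgnR (q f) else 1).symm
  have h4 : (∏ r, ∏ c, (if R r then sgnR (q (c, r)) else 1)) =
      ∏ f : Fin m × Fin k, (if R f.2 then sgnR (q f) else 1) :=
    (Fintype.prod_prod_type_right fun f : Fin m × Fin k => if R f.2 then sgnR (q f) else 1).symm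
  have h5 : chiY (xSet C R) q =
      ∏ f : Fin m × Fin k, ((if C f.1 then sgnR (q f) else 1) * (if R f.2 then sgnR (q f) else 1)) := by
    unfold chiY xSet
    rw [Finset.prod_filter]
    refine Finset.prod_congr rfl fun f _ => ?_
    cases C f.1 <;> cases R f.2 <;> simp [sgnR_mul_self]
  rw [h3, h4, h5, Finset.prod_mul_distrib]
  unfold epsCR
  ring

/-- FOURIER–WALSH EXPANSION of the parity indicator:
`1[parities q = kk] = 2^{-(m+k)} Σ_{C,R} ε(C,R) χ_{X(C,R)}(q)`. -/
theorem indicator_expand (q : Fin m × Fin k → Bool) (kk : (Fin m → Bool) × (Fin k → Bool)) :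
    (if parities q = kk then (1 : ℝ) else 0) =
      (∑ C : Fin m → Bool, ∑ R : Fin k → Bool, epsCR kk C R * chiY (xSet C R) q) / 2 ^ (m + k) := by
  have ha : (if parities q = kk then (1 : ℝ) else 0) =
      (∏ c, if colPar q c = kk.1 c then (1 : ℝ) else 0) * ∏ r, if rowPar q r = kk.2 r then (1 : ℝ) else 0 := by
    rw [Fintype.prod_boole, Fintype.prod_boole]
    by_cases h : parities q = kk
    · rw [if_pos h]
      subst h
      simp [parities]
    · rw [if_neg h]
      have h' : ¬((∀ c, colPar q c = kk.1 c) ∧ ∀ r, rowPar q r = kk.2 r) := fun hh =>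
        h (Prod.ext (funext hh.1) (funext hh.2))
      by_cases h1 : ∀ c, colPar q c = kk.1 c
      · have h2 : ¬∀ r, rowPar q r = kk.2 r := fun h2 => h' ⟨h1, h2⟩
        rw [if_neg h2, mul_zero]
      · rw [if_neg h1, zero_mul]
  rw [ha]
  simp_rw [ind_colPar, ind_rowPar]
  rw [prod_half_one_add, prod_half_one_add, Fintype.card_fin, Fintype.card_fin, div_mul_div_comm, ← pow_add,
    Finset.sum_mul_sum]
  congr 1
  exact Finset.sum_congr rfl fun C _ => Finset.sum_congr rfl fun R _ => term_eq_eps_chi q kk C R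

/-- The expansion integrated against `F`:
`E[F; parities = kk] = 2^{-(m+k)} Σ_{C,R} ε(C,R) E[χ_{X(C,R)} F]`. -/
theorem arrSum_indicator_expand :
    ∀ {m k : ℕ} (p : Fin m → ℝ) (F : (Fin m × Fin k → Bool) → ℝ) (kk : (Fin m → Bool) × (Fin k → Bool)),
      arrSum p (fun q => if parities q = kk then F q else 0) =
        (∑ C : Fin m → Bool, ∑ R : Fin k → Bool,
          epsCR kk C R * arrSum p (fun q => chiY (xSet C R) q * F q)) / 2 ^ (m + k) := by
  intro m k p F kk
  have h : ∀ q, arrWeight p q * (if parities q = kk then F q else 0) =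
      (∑ C : Fin m → Bool, ∑ R : Fin k → Bool,
        epsCR kk C R * (arrWeight p q * (chiY (xSet C R) q * F q))) / 2 ^ (m + k) := by
    intro q
    have h1 : (if parities q = kk then F q else 0) = (if parities q = kk then (1 : ℝ) else 0) * F q := by
      split_ifs <;> simp
    rw [h1, indicator_expand q kk, div_mul_eq_mul_div, mul_div_assoc', Finset.sum_mul, Finset.mul_sum]
    congr 1
    refine Finset.sum_congr rfl fun C _ => ?_
    rw [Finset.sum_mul, Finset.mul_sum]
    exact Finset.sum_congr rfl fun R _ => by ring
  unfold arrSum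
  simp_rw [h]
  rw [← Finset.sum_div, Finset.sum_comm]
  congr 1
  refine Finset.sum_congr rfl fun C _ => ?_
  rw [Finset.sum_comm]
  refine Finset.sum_congr rfl fun R _ => ?_
  rw [Finset.mul_sum]

/-- FACTORISATION BOUND: a `[0,1]`-valued `F` reading only the upper-right region satisfies
`|E[χ_X F]| ≤ θ^{#(X ∖ UR)}` (the unread entries of `X` contribute independent factors `1 - 2p`). -/
theorem abs_arrSum_chiY_mul_le (p : Fin m → ℝ) (hp : ∀ c, 0 ≤ p c ∧ p c ≤ 1) (θ : ℝ) (hθ0 : 0 ≤ θ)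
    (hθ1 : θ ≤ 1) (hpθ : ∀ c, |1 - 2 * p c| ≤ θ) (n : ℕ) (F : (Fin m × Fin k → Bool) → ℝ)
    (hF01 : ∀ q, 0 ≤ F q ∧ F q ≤ 1)
    (hF : ∀ q q' : Fin m × Fin k → Bool,
      (∀ f : Fin m × Fin k, n ≤ (f.1 : ℕ) → n ≤ (f.2 : ℕ) → q f = q' f) → F q = F q')
    (X : Finset (Fin m × Fin k)) :
    |arrSum p (fun q => chiY X q * F q)| ≤ θ ^ (X.filter fun f => ¬(n ≤ (f.1 : ℕ) ∧ n ≤ (f.2 : ℕ))).card := by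
  set Y := X.filter fun f => ¬(n ≤ (f.1 : ℕ) ∧ n ≤ (f.2 : ℕ)) with hY
  set Z := X.filter fun f => (n ≤ (f.1 : ℕ) ∧ n ≤ (f.2 : ℕ)) with hZ
  have hsplit : ∀ q, chiY X q = chiY Y q * chiY Z q := fun q => by
    unfold chiY
    rw [← Finset.prod_filter_mul_prod_filter_not X (fun f => n ≤ (f.1 : ℕ) ∧ n ≤ (f.2 : ℕ))]
    ring
  have hK : ∀ f ∈ Y, ∀ q b,
      chiY Z (Function.update q f b) * F (Function.update q f b) = chiY Z q * F q := by
    intro f hf q b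
    have hfY := (Finset.mem_filter.mp hf).2
    have hfZ : f ∉ Z := fun h => hfY (Finset.mem_filter.mp h).2
    congr 1
    · exact Finset.prod_congr rfl fun f' hf' => by
        rw [Function.update_of_ne (ne_of_mem_of_not_mem hf' hfZ)]
    · refine hF _ _ fun f' h1 h2 => ?_
      have hne : f' ≠ f := by
        rintro rfl
        exact hfY ⟨h1, h2⟩
      rw [Function.update_of_ne hne]
  have h1 : ∀ q, |chiY Z q * F q| ≤ 1 := fun q => by
    rw [abs_mul, abs_chiY, one_mul, abs_le]
    have := hF01 q
    constructor <;> linarith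
  calc |arrSum p (fun q => chiY X q * F q)| = |arrSum p (fun q => chiY Y q * (chiY Z q * F q))| := by
        simp_rw [hsplit, mul_assoc]
    _ = |∏ f ∈ Y, (1 - 2 * p f.1)| * |arrSum p (fun q => chiY Z q * F q)| := by
        rw [arrSum_chiY_mul p Y _ hK, abs_mul]
    _ ≤ θ ^ Y.card * 1 :=
        mul_le_mul (abs_prod_bias_le p θ hθ0 hθ1 hpθ Y Y.card le_rfl) (abs_arrSum_le_one p hp _ h1)
          (abs_nonneg _) (pow_nonneg hθ0 _)
    _ = θ ^ Y.card := mul_one _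

/-! ## Counting the unread entries of the exchange sets -/

/-- Case (i): if the low rows `{r < n}` meet both `R` and its complement, then `X(C,R)` has at least `m`
entries outside the upper-right region (one in each column, among the low rows). -/
theorem le_nOut_of_rows_mixed (n : ℕ) (C : Fin m → Bool) (R : Fin k → Bool) (r₀ r₁ : Fin k)
    (hr₀ : (r₀ : ℕ) < n) (hR₀ : R r₀ = true) (hr₁ : (r₁ : ℕ) < n) (hR₁ : R r₁ = false) :
    m ≤ nOut n C R := by
  unfold nOut
  let g : Fin m → Fin m × Fin k := fun c => (c, if C c then r₁ else r₀)
  calc m = (univ : Finset (Fin m)).card := by simp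
    _ ≤ _ := by
      refine Finset.card_le_card_of_injOn g (fun c _ => ?_) fun a _ b _ hab => congrArg Prod.fst hab
      simp only [Finset.coe_filter, Set.mem_setOf_eq, xSet, Finset.mem_filter, Finset.mem_univ, true_and, g]
      cases C c
      · simp only [Bool.false_eq_true, if_false, hR₀]
        exact ⟨rfl, fun h => absurd h.2 (by omega)⟩
      · simp only [if_true, hR₁]
        exact ⟨rfl, fun h => absurd h.2 (by omega)⟩

/-- Case (ii): if the low columns `{c < n}` meet both `C` and its complement, then `X(C,R)` has at least
`k` entries outside the upper-right region. -/
theorem le_nOut_of_cols_mixed (n : ℕ) (C : Fin m → Bool) (R : Fin k → Bool) (c₀ c₁ : Fin m)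
    (hc₀ : (c₀ : ℕ) < n) (hC₀ : C c₀ = true) (hc₁ : (c₁ : ℕ) < n) (hC₁ : C c₁ = false) :
    k ≤ nOut n C R := by
  unfold nOut
  let g : Fin k → Fin m × Fin k := fun r => (if R r then c₁ else c₀, r)
  calc k = (univ : Finset (Fin k)).card := by simp
    _ ≤ _ := by
      refine Finset.card_le_card_of_injOn g (fun r _ => ?_) fun a _ b _ hab => congrArg Prod.snd hab
      simp only [Finset.coe_filter, Set.mem_setOf_eq, xSet, Finset.mem_filter, Finset.mem_univ, true_and, g]
      cases R r
      · simp only [Bool.false_eq_true, if_false, hC₀]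
        exact ⟨rfl, fun h => absurd h.1 (by omega)⟩
      · simp only [if_true, hC₁]
        exact ⟨rfl, fun h => absurd h.1 (by omega)⟩

/-- Cases (iii)/(iv): if `C` and `R` are constant `= v` on the low columns/rows, then `X(C,R)` contains the
disjoint sets `{C = ¬v} × {r < n}` and `{c < n} × {R = ¬v}` outside the upper-right region. -/
theorem le_nOut_of_low_const (n : ℕ) (hnm : n ≤ m) (hnk : n ≤ k) (v : Bool) (C : Fin m → Bool)
    (R : Fin k → Bool) (hC : ∀ c : Fin m, (c : ℕ) < n → C c = v) (hR : ∀ r : Fin k, (r : ℕ) < n → R r = v) :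
    n * (univ.filter fun c => C c = !v).card + n * (univ.filter fun r => R r = !v).card ≤ nOut n C R := by
  unfold nOut
  set A := (univ.filter fun c : Fin m => C c = !v) ×ˢ (univ.filter fun r : Fin k => (r : ℕ) < n) with hA
  set B := (univ.filter fun c : Fin m => (c : ℕ) < n) ×ˢ (univ.filter fun r : Fin k => R r = !v) with hB
  have hAc : A.card = (univ.filter fun c : Fin m => C c = !v).card * n := by
    rw [hA, Finset.card_product, Fin.card_filter_val_lt, min_eq_right hnk]
  have hBc : B.card = n * (univ.filter fun r : Fin k => R r = !v).card := by
    rw [hB, Finset.card_product, Fin.card_filter_val_lt, min_eq_right hnm]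
  have hdisj : Disjoint A B := by
    rw [Finset.disjoint_left]
    rintro ⟨c, r⟩ ha hb
    simp only [hA, hB, Finset.mem_product, Finset.mem_filter, Finset.mem_univ, true_and] at ha hb
    have h := hC c hb.1
    rw [ha.1] at h
    cases v <;> simp at h
  have hsub : A ∪ B ⊆ (xSet C R).filter fun f => ¬(n ≤ (f.1 : ℕ) ∧ n ≤ (f.2 : ℕ)) := by
    intro f hf
    rw [Finset.mem_union] at hf
    simp only [hA, hB, Finset.mem_product, Finset.mem_filter, Finset.mem_univ, true_and, xSet] at hf ⊢
    rcases hf with ⟨h1, h2⟩ | ⟨h1, h2⟩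
    · refine ⟨?_, fun h => absurd h.2 (by omega)⟩
      rw [h1, hR f.2 h2]
      cases v <;> rfl
    · refine ⟨?_, fun h => absurd h.1 (by omega)⟩
      rw [h2, hC f.1 h1]
      cases v <;> rfl
  calc n * (univ.filter fun c => C c = !v).card + n * (univ.filter fun r => R r = !v).card
      = A.card + B.card := by rw [hAc, hBc]; ring
    _ = (A ∪ B).card := (Finset.card_union_of_disjoint hdisj).symm
    _ ≤ _ := Finset.card_le_card hsub

/-- Cases (v)/(vi): if `C` is constant `= v` on the low columns and `R` is constant `= ¬v` on the low rows,
then `X(C,R)` contains the whole low corner `{c < n} × {r < n}`. -/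
theorem le_nOut_of_low_mixed (n : ℕ) (hnm : n ≤ m) (hnk : n ≤ k) (v : Bool) (C : Fin m → Bool)
    (R : Fin k → Bool) (hC : ∀ c : Fin m, (c : ℕ) < n → C c = v) (hR : ∀ r : Fin k, (r : ℕ) < n → R r = !v) :
    n * n ≤ nOut n C R := by
  unfold nOut
  set A := (univ.filter fun c : Fin m => (c : ℕ) < n) ×ˢ (univ.filter fun r : Fin k => (r : ℕ) < n) with hA
  have hAc : A.card = n * n := by
    rw [hA, Finset.card_product, Fin.card_filter_val_lt, Fin.card_filter_val_lt, min_eq_right hnm,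
      min_eq_right hnk]
  have hsub : A ⊆ (xSet C R).filter fun f => ¬(n ≤ (f.1 : ℕ) ∧ n ≤ (f.2 : ℕ)) := by
    intro f hf
    simp only [hA, Finset.mem_product, Finset.mem_filter, Finset.mem_univ, true_and, xSet] at hf ⊢
    refine ⟨?_, fun h => absurd h.1 (by omega)⟩
    rw [hC f.1 hf.1, hR f.2 hf.2]
    cases v <;> rfl
  calc n * n = A.card := hAc.symm
    _ ≤ _ := Finset.card_le_card hsub

/-- The generating sum of one side: `Σ_{C : low part ≡ v} T^{#{C = ¬v}} = (1 + T)^{m - n}`. -/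
theorem sum_low_const_pow (n : ℕ) (hnm : n ≤ m) (v : Bool) (T : ℝ) :
    ∑ C : Fin m → Bool, (if ∀ c : Fin m, (c : ℕ) < n → C c = v then
        T ^ (univ.filter fun c => C c = !v).card else 0) = (1 + T) ^ (m - n) := by
  -- the summand is a product of one-coordinate factors
  set g : Fin m → Bool → ℝ := fun c b => if b = !v then (if (c : ℕ) < n then 0 else T) else 1 with hg
  have hterm : ∀ C : Fin m → Bool, (if ∀ c : Fin m, (c : ℕ) < n → C c = v then
      T ^ (univ.filter fun c => C c = !v).card else 0) = ∏ c, g c (C c) := by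
    intro C
    split_ifs with hC
    · have hfac : ∀ c, g c (C c) = if C c = !v then T else 1 := by
        intro c
        by_cases hc : (c : ℕ) < n
        · have := hC c hc
          rw [this]
          cases v <;> simp [hg]
        · simp [hg, hc]
      simp only [hfac]
      rw [Finset.prod_ite, Finset.prod_const, Finset.prod_const_one, mul_one]
    · push Not at hC
      obtain ⟨c, hc, hCc⟩ := hC
      refine (Finset.prod_eq_zero (Finset.mem_univ c) ?_).symm
      have hCc' : C c = !v := by
        revert hCc
        cases C c <;> cases v <;> simp
      simp [hg, hCc', hc]
  simp only [hterm]
  rw [← Fintype.prod_sum fun (c : Fin m) (b : Bool) => g c b]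
  have hsum : ∀ c : Fin m, ∑ b : Bool, g c b = if (c : ℕ) < n then 1 else 1 + T := by
    intro c
    rw [Fintype.sum_bool]
    by_cases hc : (c : ℕ) < n
    · cases v <;> simp [hg, hc]
    · cases v <;> simp [hg, hc, add_comm]
  simp only [hsum]
  rw [Finset.prod_ite, Finset.prod_const_one, one_mul, Finset.prod_const]
  congr 1
  have h := Finset.card_filter_add_card_filter_not (s := (univ : Finset (Fin m)))
    (fun c : Fin m => (c : ℕ) < n)
  rw [Fin.card_filter_val_lt, min_eq_right hnm, Finset.card_univ, Fintype.card_fin] at h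
  omega

/-- The generating sum over pairs: `Σ_{(C,R) : low parts ≡ v} T^{#{C = ¬v}} T^{#{R = ¬v}} = (1 + T)^{m + k - 2n}`. -/
theorem sum_pair_low_const_pow (n : ℕ) (hnm : n ≤ m) (hnk : n ≤ k) (v : Bool) (T : ℝ) :
    ∑ x : (Fin m → Bool) × (Fin k → Bool),
      (if (∀ c : Fin m, (c : ℕ) < n → x.1 c = v) ∧ (∀ r : Fin k, (r : ℕ) < n → x.2 r = v) then
        T ^ (univ.filter fun c => x.1 c = !v).card * T ^ (univ.filter fun r => x.2 r = !v).card else 0) =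
      (1 + T) ^ (m + k - 2 * n) := by
  rw [show (∑ x : (Fin m → Bool) × (Fin k → Bool),
      (if (∀ c : Fin m, (c : ℕ) < n → x.1 c = v) ∧ (∀ r : Fin k, (r : ℕ) < n → x.2 r = v) then
        T ^ (univ.filter fun c => x.1 c = !v).card * T ^ (univ.filter fun r => x.2 r = !v).card else 0)) =
      ∑ C : Fin m → Bool, ∑ R : Fin k → Bool,
        (if (∀ c : Fin m, (c : ℕ) < n → C c = v) ∧ (∀ r : Fin k, (r : ℕ) < n → R r = v) then
          T ^ (univ.filter fun c => C c = !v).card * T ^ (univ.filter fun r => R r = !v).card else 0) from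
    Fintype.sum_prod_type' fun (C : Fin m → Bool) (R : Fin k → Bool) =>
      if (∀ c : Fin m, (c : ℕ) < n → C c = v) ∧ (∀ r : Fin k, (r : ℕ) < n → R r = v) then
        T ^ (univ.filter fun c => C c = !v).card * T ^ (univ.filter fun r => R r = !v).card else 0]
  have hsplit : ∀ (C : Fin m → Bool) (R : Fin k → Bool),
      (if (∀ c : Fin m, (c : ℕ) < n → C c = v) ∧ (∀ r : Fin k, (r : ℕ) < n → R r = v) then
        T ^ (univ.filter fun c => C c = !v).card * T ^ (univ.filter fun r => R r = !v).card else 0) =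
      (if ∀ c : Fin m, (c : ℕ) < n → C c = v then T ^ (univ.filter fun c => C c = !v).card else 0) *
        (if ∀ r : Fin k, (r : ℕ) < n → R r = v then T ^ (univ.filter fun r => R r = !v).card else 0) := by
    intro C R
    split_ifs with h h1 h2 h2 h1 <;> simp_all
  simp only [hsplit]
  rw [← Finset.sum_mul_sum, sum_low_const_pow n hnm v T, sum_low_const_pow n hnk v T, ← pow_add]
  congr 1
  omega

end Summit.CriticalPhenomena.CardyFormulaZ2.Theorems.IKLinearTransport.PinnedDiagramExchange.ScreeningArray
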